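import Summits.QuantumFields.YangMills.Theorems.BalabanUVNodesN15KingModelPotentialDressedCarriersSizeOnly
import Summits.QuantumFields.YangMills.Theorems.BalabanUVNodesN15KingModelPotentialUnitSizeOnly
import Literature.MathematicalPhysics.QuantumFieldTheory.Balaban1983to89.B11AxialTransport190

/-!
# N15 (NE2⁺), King-model rung, part 26: SIZE ALONE DOES NOT GIVE THE OPERATOR LAYER EITHER — `¬ NE2PlusOperator` on the size-only carriers

Cell `pub-ymgap-dag-n15-d` (R134 acceleration DAG, node N15 = NE2, strategy s3 KING-MODEL RUNG), part 26.  Part 16 inhabited `NE2PlusOperator` BY NAME for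
the dressed covariances' (3.42) entry family on the size-AND-coherence carriers (`ne2PlusOperator_kingSC`); part 25 built the same carriers on part 8c's
size-only sort (`kingInstanceVν`, `kingOpV`, `kingCarriersV`) and refuted the node's K4 face there through the SITE conjunct.  THIS FILE refutes the
OPERATOR conjunct as well — so on the size-only reading exactly ONE of the three NE2⁺ layers survives (the unit layer, which reads the coherence slot):

* §1 `supNorm_single_le_one`, `loc_single_ge` — bookkeeping for the point source `δ_b` in n15-b's `opFamily` ∕ `BlockNorm.ofBlocks` currency (every site
  its own block): the sup norm of `δ_b` is `≤ 1` and the entry-0 readout of a kernel operator `𝔎` at `(δ_b, b)` dominates `|K(b,b)|`;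
* §2 ★★ `not_ne2PlusOperator_kingV : ¬ NE2PlusOperator c₃₅ (kingInstanceVν L s) (kingOpV L a m² s)` (`L ≥ 2`, `a, m² > 0`, every `c₃₅ > 0`, `s`):
  given `(M₅, δ₀, a₀, B₀, γ)`, at the index `((0, k, 1, max M₅ 1), 0)`, `α₀ = a₀∕max M₅ 1`, with the (3.35)-regular incoherent tower `v_N = c₃₅α₀·[N = L^k]`,
  `EtaRateIneq342` at entry `n = 0`, test function `δ_b` and sites `y = y′ = b` reads `|C^{(k+1)}_v(b,b) − C^{(k)}_v(b,b)| ≤ B₀(L^k)^{−γ}`, against part 22's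
  `kingKerVW_sizeOnly_ge` (`≥ g − K·L^{−k}`) — false for `k` large;
* `n15At_kingModelV_conjuncts` — the three conjuncts of `N15At (kingCarriersV …)` individually: operator FALSE, site FALSE (part 25∕21), unit TRUE (10d).

HONEST SCOPE.  King's A = 0 scalar model on the King-admissible tori, `L ≥ 2` (`odd L ≥ 3` where the site layer is quoted), `a, m² > 0`; scalar potentials
(NOT gauge fields); OUR slot readings; negative statements about THIS LINEAGE's families; NOT Bałaban's carriers of record, not `G_k(U)` ∕ `C^{(k)}(Λ;U)`;
count-neutral (`--supports`), not a discharge of N15; THEOREMS ONLY (0 `def`, 0 `sorry`), standard axioms.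

References: [B9] = Bałaban, Commun. Math. Phys. 102 (1985) 385–462, (3.35)–(3.36) p.396, Thm 3.1 (3.42) p.397, Thm 3.14 pp.426–427 (quantifier template)
(bib key `Balaban1985BackgroundPropagators`); C. King, Commun. Math. Phys. 102 (1986) 649–677, Lemma 4.5 (4.38) p.674 (A = 0 model) (bib key `King1986`).
-/

noncomputable section
open scoped BigOperators

namespace Summit.QuantumFields.YangMills.BalabanUVNodes.N15.KingModel

open Literature.MathematicalPhysics.QuantumFieldTheory.Balaban1983to89 hiding blockOf
open Literature.MathematicalPhysics.QuantumFieldTheory.Balaban1983to89.B11SectG (BlockNorm)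
open Literature.MathematicalPhysics.QuantumFieldTheory.Balaban1983to89.B11AxialTransport190 (abs_le_loc_ofBlocks)
open Literature.MathematicalPhysics.QuantumFieldTheory.Balaban1983to89.T4EtaRate (PairedInstance EtaRateIneq342 NE2PlusOperator NE2PlusSite
  NE2PlusUnit rateFactor)
open Literature.MathematicalPhysics.QuantumFieldTheory.Balaban1983to89.B5Prop11Plancherel (Tor fine)
open Literature.MathematicalPhysics.QuantumFieldTheory.King1986.Torus (tdistT tdistT_isPseudoDist)
open Summit.QuantumFields.YangMills.BalabanUVNodes.N15.OperatorReadout (opGeo opFamily opGeo_len rateFactor_opGeo)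
open YMDAG.UVSplit (NE2Carriers N15At)
open Real

variable {d : ℕ}

/-! ## §1 Point sources in the `opFamily` currency -/

section PointSource

variable (Kt : Fin (d + 1) → ℕ) [∀ μ, NeZero (Kt μ)]

omit [∀ μ, NeZero (Kt μ)] in
/-- The sup norm of a point source is at most one. [folklore] -/
theorem supNorm_single_le_one (b : Tor Kt) : (⨆ x : Tor Kt, |(Pi.single b (1 : ℝ) : Tor Kt → ℝ) x|) ≤ 1 := by
  refine Real.iSup_le (fun x => ?_) zero_le_one
  by_cases h : x = b
  · subst h; rw [Pi.single_eq_same, abs_one]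
  · rw [Pi.single_eq_of_ne h, abs_zero]; exact zero_le_one

/-- In the every-site-its-own-block norm of a King geometry, the localisation at `b` of `𝔎δ_b` dominates `|K(b,b)|` (the tree's `abs_le_loc_ofBlocks`).
[folklore] -/
theorem loc_single_ge (L lvl : ℕ) (Msz : ℝ) (K : Matrix (Tor Kt) (Tor Kt) ℝ) (b : Tor Kt) :
    |K b b| ≤ (BlockNorm.ofBlocks (kingGeo L lvl Kt Msz) (fun x : Tor Kt => x)).loc b (Matrix.mulVecLin K (Pi.single b 1)) := by
  have h := abs_le_loc_ofBlocks (g := kingGeo L lvl Kt Msz) (fun x : Tor Kt => x) (Matrix.mulVecLin K (Pi.single b 1)) (x' := b) (y := b) rfl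
  rwa [mulVecLin_single_apply] at h

end PointSource

/-! ## §2 `NE2PlusOperator` fails on the size-only carriers -/

section NotOperator

variable (L : ℕ) [NeZero L]

/-- **`NE2PlusOperator` FAILS FOR THE DRESSED COVARIANCES' ENTRY FAMILY ON THE SIZE-ONLY SORT** (`L ≥ 2`, `a, m² > 0`; every `c₃₅ > 0`, `s`):
`¬ NE2PlusOperator c₃₅ (kingInstanceVν L s) (kingOpV L a m² s)` (module docstring §2).  CONTRAST: on the size-and-coherence carriers the predicate HOLDS
(part 16 `ne2PlusOperator_kingSC`).  HONEST SCOPE: module docstring.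
[cite: Balaban1985BackgroundPropagators, (3.35) p.396 + Thm 3.1 (3.42) p.397 + Thm 3.14 pp.426–427 (quantifier template); King1986, Lemma 4.5 (4.38) p.674 (A = 0 model)] -/
theorem not_ne2PlusOperator_kingV (hL : 2 ≤ L) {a m2 : ℝ} (ha : 0 < a) (hm : 0 < m2) {c35 : ℝ} (hc : 0 < c35) (s : ℝ) :
    ¬ NE2PlusOperator c35 (kingInstanceVν (d := d) L s) (kingOpV L a m2 s) := by
  rintro ⟨M₅, δ₀, a₀, B₀, γ, hM, hδ, ha₀, hB, hγ, H⟩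
  have hL1 : 1 < L := by omega
  have hLr : (1 : ℝ) < L := by exact_mod_cast hL1
  have hL0 : (0 : ℝ) < L := by linarith
  -- the size letter and the window
  set Msz : ℝ := max M₅ 1 with hMszdef
  have hMsz1 : 1 ≤ Msz := le_max_right _ _
  have hMszpos : 0 < Msz := by positivity
  set α₀ : ℝ := a₀ / Msz with hα₀def
  have hα₀ : 0 < α₀ := by positivity
  have hMa : Msz * α₀ ≤ a₀ := by rw [hα₀def, mul_div_cancel₀ a₀ hMszpos.ne']
  have hcα : 0 < c35 * α₀ := by positivity
  obtain ⟨g, K, hg, hK, Hlow⟩ := kingKerVW_sizeOnly_ge (d := d) L hL ha hm hcα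
  -- the two rates and a level beating both
  set r : ℝ := (L : ℝ)⁻¹ with hrdef
  set θ : ℝ := (L : ℝ) ^ (-γ) with hθdef
  have hr0 : 0 ≤ r := by positivity
  have hr1 : r < 1 := inv_lt_one_of_one_lt₀ hLr
  have hθ0 : 0 ≤ θ := Real.rpow_nonneg (Nat.cast_nonneg _) _
  have hθ1 : θ < 1 := Real.rpow_lt_one_of_one_lt_of_neg hLr (by linarith)
  obtain ⟨n₁, hn₁⟩ := exists_pow_lt_of_lt_one (show 0 < g / 4 / (K + 1) by positivity) hr1
  obtain ⟨n₂, hn₂⟩ := exists_pow_lt_of_lt_one (show 0 < g / 4 / B₀ by positivity) hθ1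
  set k : ℕ := n₁ + n₂ + 1 with hkdef
  have hk1 : 1 ≤ k := by omega
  have hrk : r ^ k ≤ r ^ n₁ := pow_le_pow_of_le_one hr0 hr1.le (by omega)
  have hθk : θ ^ k ≤ θ ^ n₂ := pow_le_pow_of_le_one hθ0 hθ1.le (by omega)
  have hsmall₁ : K * r ^ k ≤ g / 4 := by
    have h1 : K * r ^ k ≤ (K + 1) * r ^ n₁ := mul_le_mul (by linarith) hrk (pow_nonneg hr0 _) (by linarith)
    have h3 : (K + 1) * (g / 4 / (K + 1)) = g / 4 := by field_simp
    linarith [mul_le_mul_of_nonneg_left hn₁.le (by linarith : (0 : ℝ) ≤ K + 1)]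
  have hsmall₂ : B₀ * θ ^ k ≤ g / 4 := by
    have h3 : B₀ * (g / 4 / B₀) = g / 4 := by field_simp
    linarith [mul_le_mul_of_nonneg_left (hθk.trans hn₂.le) hB.le]
  -- the index `((0, k, 1, Msz), 0)`, the site `b`, the point source, and the (3.35)-regular incoherent tower
  set i : KingPotIdx d := ⟨0, k, hk1, 1, le_rfl, Msz, hMsz1⟩ with hidef
  set b : Tor (kingU d L 0) := fun _ => 0 with hbdef
  set V : (kingInstanceVν (d := d) L s (i, 0)).Bf.Cfg := fun N _ => if N = L ^ k then c35 * α₀ else 0 with hVdef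
  have h335 : (kingInstanceVν (d := d) L s (i, 0)).Bf.Reg335 c35 α₀ V := by
    intro N x
    show |(if N = L ^ k then c35 * α₀ else (0 : ℝ))| ≤ c35 * α₀
    by_cases h : N = L ^ k
    · rw [if_pos h, abs_of_pos hcα]
    · rw [if_neg h, abs_zero]; exact hcα.le
  set lam : Tor (kingU d L 0) → ℝ := Pi.single b 1 with hlamdef
  have hsupp : (kingInstanceVν (d := d) L s (i, 0)).gc.suppIn lam b := by
    intro x hx
    exact Pi.single_eq_of_ne hx _
  have hineq := H (i, 0) (le_max_left M₅ 1) α₀ hα₀ hMa V h335 0 lam b b hsupp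
  -- the right-hand side: `≤ B₀ θ^k`
  have hη : (kingGeo L i.k (kingU d L i.e) i.Msz).eta ≠ 0 := by
    show (((L : ℝ) ^ i.k))⁻¹ ≠ 0; positivity
  have hlen : (kingInstanceVν (d := d) L s (i, 0)).gc.len b = 1 := kingGeo_len (NeZero.ne L) k (kingU d L 0) Msz b
  have hrf : rateFactor (kingInstanceVν (d := d) L s (i, 0)).gc γ b = θ ^ k := by
    show rateFactor (opGeo (kingGeo L i.k (kingU d L i.e) i.Msz) (Tor (kingU d L i.e)) (fun x => x)) γ b = θ ^ k
    rw [rateFactor_opGeo _ _ _ hη hL0, T4EtaRateDefect.rateWeight]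
    show ((L : ℝ) ^ k) ^ (-γ) = ((L : ℝ) ^ (-γ)) ^ k
    exact (Real.rpow_pow_comm hL0.le _ _).symm
  have hpref : B9.pref4 (1 : ℝ) 0 = 1 := by simp [B9.pref4]
  have hsup : (kingInstanceVν (d := d) L s (i, 0)).gc.supNorm lam ≤ 1 := supNorm_single_le_one (kingU d L 0) b
  have hexp : Real.exp (-(δ₀ * (kingInstanceVν (d := d) L s (i, 0)).gc.dist b b)) ≤ 1 := by
    rw [Real.exp_le_one_iff]
    have h0 : 0 ≤ (kingInstanceVν (d := d) L s (i, 0)).gc.dist b b := (tdistT_isPseudoDist (kingU d L 0)).nonneg b b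
    nlinarith
  rw [hlen, hpref, hrf, max_self, mul_one] at hineq
  have hup : (kingOpV L a m2 s (i, 0)).e 0 V lam b ≤ B₀ * θ ^ k := by
    refine hineq.trans ?_
    have h1 : B₀ * Real.exp (-(δ₀ * (kingInstanceVν (d := d) L s (i, 0)).gc.dist b b)) ≤ B₀ := mul_le_of_le_one_right hB.le hexp
    have h2 : B₀ * Real.exp (-(δ₀ * (kingInstanceVν (d := d) L s (i, 0)).gc.dist b b)) * θ ^ k ≤ B₀ * θ ^ k :=
      mul_le_mul_of_nonneg_right h1 (pow_nonneg hθ0 _)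
    calc _ ≤ B₀ * Real.exp (-(δ₀ * (kingInstanceVν (d := d) L s (i, 0)).gc.dist b b)) * θ ^ k * 1 :=
          mul_le_mul_of_nonneg_left hsup (by positivity)
      _ ≤ B₀ * θ ^ k := by rw [mul_one]; exact h2
  -- the left-hand side: `≥ |C^{(k+1)}_v(b,b) − C^{(k)}_v(b,b)| ≥ g − K r^k`
  have hlo : |kingKerMat L a m2 s i V b b| ≤ (kingOpV L a m2 s (i, 0)).e 0 V lam b :=
    loc_single_ge (kingU d L 0) L k Msz (kingKerMat L a m2 s i V) b
  have hlow := Hlow s i b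
  rw [show i.k = k from rfl] at hlow
  have hker : (kingKerVW L a m2 s i).ker (fun N _ => if N = L ^ k then c35 * α₀ else 0) b b ≤ |kingKerMat L a m2 s i V b b| :=
    le_abs_self _
  linarith

/-- **THE THREE CONJUNCTS OF `N15At` ON THE SIZE-ONLY CARRIERS, INDIVIDUALLY** (odd `L ≥ 3`, `a, m² > 0`, `c₃₅ > 0`, `0 ≤ s ≤ L^{−1∕2}`, every `p`): the
OPERATOR conjunct is FALSE (this file), the SITE conjunct is FALSE (parts 21∕25), the UNIT conjunct is TRUE (part 10d, via part 25) — the unit layer is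
the one NE2⁺ layer whose predicate reads the coherence slot (3.36). [cite: Balaban1985BackgroundPropagators, Thm 3.1 p.397 + Thm 3.14 pp.426–427 + Thm 3.15 (3.187) p.432 (quantifier templates); King1986, Lemma 4.5 (4.38) p.674 (A = 0 model)] -/
theorem n15At_kingModelV_conjuncts (d : ℕ) {L : ℕ} [NeZero L] (hLodd : Odd L) (hL : 2 ≤ L) {a m2 : ℝ} (ha : 0 < a) (hm : 0 < m2)
    {c35 : ℝ} (hc : 0 < c35) {s : ℝ} (hs0 : 0 ≤ s) (hs1 : s ≤ (L : ℝ) ^ (-(1 / 2 : ℝ))) (p : ℝ) :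
    ¬ NE2PlusOperator (kingCarriersV d L a m2 s c35 p).c35 (kingCarriersV d L a m2 s c35 p).pi (kingCarriersV d L a m2 s c35 p).Kop
    ∧ ¬ NE2PlusSite 4 (kingCarriersV d L a m2 s c35 p).p (kingCarriersV d L a m2 s c35 p).c35 (kingCarriersV d L a m2 s c35 p).pi
        (kingCarriersV d L a m2 s c35 p).Ksite
    ∧ NE2PlusUnit (kingCarriersV d L a m2 s c35 p).c35 (kingCarriersV d L a m2 s c35 p).pi (kingCarriersV d L a m2 s c35 p).Kunit
        (kingCarriersV d L a m2 s c35 p).inΛ (kingCarriersV d L a m2 s c35 p).unitDist := by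
  refine ⟨not_ne2PlusOperator_kingV L hL ha hm hc s, fun hsite => ?_, ne2PlusUnit_kingCarriersV d hLodd hL ha hm hc hs0 hs1 p⟩
  obtain ⟨M₅, δ, a₀, C, γ, hM, hδ, ha₀, hC, hγ, H⟩ := hsite
  exact not_ne2PlusSite_kingHV (d := d) L hLodd hL ha hm hc s 4 p
    ⟨M₅, δ, a₀, C, γ, hM, hδ, ha₀, hC, hγ, fun i hMi α₀ hα hMa v h335 => H (i, 0) hMi α₀ hα hMa v h335⟩

end NotOperator

end Summit.QuantumFields.YangMills.BalabanUVNodes.N15.KingModel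

end
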